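import Summits.CriticalPhenomena.CardyFormulaZ2.Theses.CardyUniqueLimit
import Summits.CriticalPhenomena.CardyFormulaZ2.Theses.CardyWhiteToColoured
import Literature.Probability.Percolation.QuadCrossingRotationUniformity

/-!
# Sketch C (census only, NOT registered): line `euclid-upgrade` for X_U

X_U ⇐ LimitExists (stmt-0747) ∧ EuclidOfLimits (new, theorem-grade modulo the DKKMO fact) ∧
SimilarityUpgrade (stmt-4597 verbatim, CardyWhiteToColoured r3). Typed here to make the census concrete.
-/

noncomputable section

namespace Summit.CriticalPhenomena.CardyFormulaZ2.Cruxes.CardyUniqueLimitThesis.EuclidUpgradeSketch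

open Filter Topology Set
open Literature.Probability.RandomPlanarGeometry
open Literature.Probability.Percolation (bondDomainCrossingProb)

/-- E: given full limits for every conformal rectangle and DKKMO's rotation invariance, the limit
functional is similarity-invariant (translations: lattice subsequences; dilations: exact mesh rescaling;
quarter turns: exact; general rotations: DKKMO + the quadCrossing/discreteCrossing dictionary). [folklore] -/
def EuclidOfLimits : Prop :=
  Literature.Probability.Percolation.dkkmo_crossing_rotation_invariance →
  ∀ Φ : ConformalRectangle → ℝ,
    (∀ R : ConformalRectangle, Tendsto (bondDomainCrossingProb R) (𝓝[>] 0) (𝓝 (Φ R))) →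
    ∀ (R R' : ConformalRectangle) (a w : ℂ), a ≠ 0 →
      R'.carrier = (fun z : ℂ => a * z + w) '' R.carrier →
      R'.arc 0 = (fun z : ℂ => a * z + w) '' R.arc 0 →
      R'.arc 2 = (fun z : ℂ => a * z + w) '' R.arc 2 → Φ R' = Φ R

/-- The composition of line C (sorry-free): LimitExists → EuclidOfLimits → DKKMO → SimilarityUpgrade → X_U.
[folklore] -/
theorem thesis_of_lineC
    (h₁ : Summit.CriticalPhenomena.CardyFormulaZ2.Theses.CardyUniqueLimit.LimitExists)
    (hE : EuclidOfLimits)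
    (hD : Literature.Probability.Percolation.dkkmo_crossing_rotation_invariance)
    (hU : Summit.CriticalPhenomena.CardyFormulaZ2.Theses.CardyWhiteToColoured.SimilarityUpgrade) :
    Summit.CriticalPhenomena.CardyFormulaZ2.Theses.CardyUniqueLimit.CardyUniqueLimitThesis := by
  classical
  set Φ : ConformalRectangle → ℝ := fun R => Classical.choose (h₁ R) with hΦ
  have hlim : ∀ R : ConformalRectangle, Tendsto (bondDomainCrossingProb R) (𝓝[>] 0) (𝓝 (Φ R)) :=
    fun R => Classical.choose_spec (h₁ R)
  exact hU ⟨Φ, hlim, fun R R' a w ha hc h0 h2 => hE hD Φ hlim R R' a w ha hc h0 h2⟩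

/-- Conversely ConfInvTransport (stmt-0794) already implies SimilarityUpgrade's conclusion from its
hypothesis (full limits give an anchor of every modulus); so line C's conformal stub is logically WEAKER
than birth's, at the price of FULL LimitExists. Recorded for the census. [folklore] -/
theorem similarityUpgrade_of_confInvTransport
    (h₂ : Summit.CriticalPhenomena.CardyFormulaZ2.Theses.CardyUniqueLimit.ConfInvTransport) :
    Summit.CriticalPhenomena.CardyFormulaZ2.Theses.CardyWhiteToColoured.SimilarityUpgrade := by
  classical
  rintro ⟨Φ, hlim, -⟩
  refine ⟨fun η => if hη : ∃ (R : ConformalRectangle)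
      (φ : ConformalEquiv UpperHalfPlane.upperHalfPlaneSet R.carrier) (x : Fin 4 → ℝ),
      R.IsUniformizing φ x ∧ crossRatio x = η then Φ (Classical.choose hη) else 0, ?_⟩
  intro R φ x hφ
  have hW : ∃ (R'' : ConformalRectangle)
      (φ'' : ConformalEquiv UpperHalfPlane.upperHalfPlaneSet R''.carrier) (x'' : Fin 4 → ℝ),
      R''.IsUniformizing φ'' x'' ∧ crossRatio x'' = crossRatio x := ⟨R, φ, x, hφ, rfl⟩
  show Tendsto (bondDomainCrossingProb R) (𝓝[>] 0)
    (𝓝 (if hη : ∃ (R'' : ConformalRectangle)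
      (φ'' : ConformalEquiv UpperHalfPlane.upperHalfPlaneSet R''.carrier) (x'' : Fin 4 → ℝ),
      R''.IsUniformizing φ'' x'' ∧ crossRatio x'' = crossRatio x then Φ (Classical.choose hη) else 0))
  rw [dif_pos hW]
  obtain ⟨φ'', x'', hφ'', hcr⟩ := Classical.choose_spec hW
  exact h₂ (Classical.choose hW) R φ'' x'' φ x hφ'' hφ hcr _ (hlim _)

end Summit.CriticalPhenomena.CardyFormulaZ2.Cruxes.CardyUniqueLimitThesis.EuclidUpgradeSketch

end
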